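import Summits.CriticalPhenomena.PercolationContinuityZ3.Theorems.PercNearOneGluingNoHeavyQuantFlowPieces
import Summits.CriticalPhenomena.PercolationContinuityZ3.Theorems.PercNearOneGluingNoHeavyQuantSliceTwoRowRates
import Summits.CriticalPhenomena.PercolationContinuityZ3.Theorems.PercNearOneGluingNoHeavyQuantLawDecUsageMonge
import Summits.CriticalPhenomena.PercolationContinuityZ3.Theorems.PercNearOneGluingNoHeavyQuantSliceSmallLayers
import HarnessLib

/-!
# QUANT lane R8, T-DEC, leg (III): rate inequalities and law facts for the BLOB GATE MOVE (part 1 of 3)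

builds on p205010 (kernel theorem, internal audit signed; external expert review pending)

Support file (`--supports stmt-CriticalPhenomena-4575`), QUANT lane typer seat prim-quant-stmt (gen 27), rung R8 of
`run/shared/lean/prim/quant/LADDER.md`.  Theorems only, standard axioms, no sorries, no definitions.

THE SETTING (parts 2–3, `…QuantGateMoveBlobPartial`, `…QuantGateMoveBlob`).  The blob instance of typer g26's `LawDec.GateMove` is the
two-law MOVE: for a probability law `ν` on `{0..M}` (mean `S`, top-affordable `y·M ≤ S`, `ν 0 ≥ z`), a heavy blob `(a, g)` and a
floor `y ≤ (1−z)·g`, the slice `Λ = slice ν a g` at target `τ = S + a·g` and the law `P = Λ + g·z·(δ₀ − δ_a)` (the `z`-part of the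
shifted zero atom moved back to `0`) at target `t = τ − z·a·g`; with `ν = gate_q μ`, `z = 1 − q` this is `slice (gate_q μ) a g ⟶
gate_q (slice μ a g)`, i.e. SDEC closed under hanging a blob beside a law under a common gate.  This file collects what the flow
transfer of part 2 needs about the RATES `LawDec.usage` when the target drops from `τ` to `t` and when a displaced low atom re-uses the
mid slots vacated by the atom `0` or by the atom `a`:
* `usage_le_of_pairGate_le` / `usage_le_of_rho_le` — at a mid, usage is monotone in the minimal gate, hence in `ρ = (T − 2l)/(h − l)`;
* `rho_le_of_target_le` (same pair, smaller target), `rho_le_rho_zero` (a nonzero low at target `t` versus the atom `0` at target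
  `τ ≥ t` on a mid `h ≥ τ/2`), `rho_le_rho_of_le_low` (a low `l ≥ a` at `t` versus `a` at `τ` on a mid `h` with `2h ≥ τ`);
* `pair_mean_le` — a compatible mid pair at its minimal gate has "mean ≤ target" in the unnormalised form `l·x + h·u·x ≤ t·(x + u·x)`.

[this work]; flow normal form / rates: this lane (typer g22, lead g21, typer g25–g26, census-2 g54).  The gluing rows served
[cite: KozmaNitzan2024, Conjecture 3 (p. 15)]; product measure [cite: Grimmett1999, §1.3 p. 10].
-/

noncomputable section

namespace Summit.CriticalPhenomena.PercolationContinuityZ3.Theorems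

namespace Quant

open Finset

namespace LawDec

/-! ### Usage at a mid is monotone in the minimal gate -/

/-- **usage at a mid is monotone in `ρ`**: for mids `h ≤ j` and pairs `(l₁, h)` at target `T₁`, `(l₂, h)` at target `T₂` with the second
pair a genuine compatible low pair (`2l₂ < T₂ < l₂ + h`, so that its minimal gate is `< 1`), `ρ₁ ≤ ρ₂` implies
`usage y T₁ j l₁ h ≤ usage y T₂ j l₂ h` (`0 < y < 1`). [this work] -/
theorem usage_le_of_rho_le (y T₁ T₂ : ℝ) (j l₁ l₂ h : ℕ) (hy0 : 0 < y) (hy1 : y < 1) (hhj : h ≤ j)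
    (hlow2 : 2 * (l₂ : ℝ) < T₂) (hcomp2 : T₂ < (l₂ : ℝ) + h)
    (hρ : (T₁ - 2 * (l₁ : ℝ)) / ((h : ℝ) - l₁) ≤ (T₂ - 2 * (l₂ : ℝ)) / ((h : ℝ) - l₂)) :
    usage y T₁ j l₁ h ≤ usage y T₂ j l₂ h := by
  have hnj : ¬ (j + 1 ≤ h) := by omega
  simp only [usage, gateOf, if_neg hnj]
  have hγ : pairGate y T₁ l₁ h ≤ pairGate y T₂ l₂ h := pairGate_mono_rho y T₁ T₂ l₁ h l₂ h hy1.le hρ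
  have hγ1 : pairGate y T₂ l₂ h < 1 := pairGate_lt_one y T₂ l₂ h hy0 hy1 hlow2 hcomp2
  have h1 : 0 < 1 - pairGate y T₂ l₂ h := by linarith
  have h2 : 0 < 1 - pairGate y T₁ l₁ h := by linarith
  rw [div_le_div_iff₀ h2 h1]
  nlinarith

/-- **lowering the target lowers `ρ`**: `t ≤ τ`, `l < h` ⟹ `(t − 2l)/(h − l) ≤ (τ − 2l)/(h − l)`. [this work] -/
theorem rho_le_of_target_le (t τ : ℝ) (l h : ℕ) (hlh : l < h) (htt : t ≤ τ) :
    (t - 2 * (l : ℝ)) / ((h : ℝ) - l) ≤ (τ - 2 * (l : ℝ)) / ((h : ℝ) - l) := by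
  have hd : (0 : ℝ) < (h : ℝ) - l := by
    have : (l : ℝ) < h := by exact_mod_cast hlh
    linarith
  exact div_le_div_of_nonneg_right (by linarith) hd.le

/-- **a nonzero low in the zero's slot**: for `t ≤ τ`, a low `l` with `2l < t` and a mid `h` with `τ ≤ 2h` (in particular any
`h > τ`), `(t − 2l)/(h − l) ≤ τ/h = (τ − 2·0)/(h − 0)`. [this work] -/
theorem rho_le_rho_zero (t τ : ℝ) (l h : ℕ) (htt : t ≤ τ) (hlow : 2 * (l : ℝ) < t) (hh : τ ≤ 2 * (h : ℝ)) :
    (t - 2 * (l : ℝ)) / ((h : ℝ) - l) ≤ (τ - 2 * ((0 : ℕ) : ℝ)) / ((h : ℝ) - ((0 : ℕ) : ℝ)) := by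
  have hl0 : (0 : ℝ) ≤ l := Nat.cast_nonneg l
  have hlh : (l : ℝ) < h := by nlinarith
  have hd : (0 : ℝ) < (h : ℝ) - l := by linarith
  have hh0 : (0 : ℝ) < h := by linarith
  push_cast
  rw [mul_zero, sub_zero, sub_zero, div_le_div_iff₀ hd hh0]
  nlinarith

/-- **a low `l ≥ a` in the slot of `a`**: for `t ≤ τ`, `a ≤ l`, `2l < t`, `l < h` and a mid `h` with `τ ≤ 2h`,
`(t − 2l)/(h − l) ≤ (τ − 2a)/(h − a)`. [this work] -/
theorem rho_le_rho_of_le_low (t τ : ℝ) (a l h : ℕ) (htt : t ≤ τ) (hal : a ≤ l) (hlh : l < h) (hh : τ ≤ 2 * (h : ℝ)) :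
    (t - 2 * (l : ℝ)) / ((h : ℝ) - l) ≤ (τ - 2 * (a : ℝ)) / ((h : ℝ) - a) := by
  have hal' : (a : ℝ) ≤ l := by exact_mod_cast hal
  have hlh' : (l : ℝ) < h := by exact_mod_cast hlh
  have hd : (0 : ℝ) < (h : ℝ) - l := by linarith
  have hd' : (0 : ℝ) < (h : ℝ) - a := by linarith
  rw [div_le_div_iff₀ hd hd']
  -- `(t − 2l)(h − a) ≤ (τ − 2l)(h − a) ≤ (τ − 2a)(h − l)`, the last step being `(l − a)(τ − 2h) ≤ 0`
  nlinarith [mul_le_mul_of_nonneg_right htt hd'.le, mul_nonneg (sub_nonneg.2 hal') (by linarith : (0 : ℝ) ≤ 2 * (h : ℝ) - τ)]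

/-- **a compatible mid pair at its minimal gate has mean at most the target**, unnormalised: for a low `l` (`2l < t`), a mid `h ≤ j`
with `t < l + h` and `y·h ≤ t` (`0 < y < 1`), and a mass `x ≥ 0` shipped through the pair, `l·x + h·(usage·x) ≤ t·(x + usage·x)`.
(`usage_mid_mul_le`.) [this work] -/
theorem pair_mean_le (y t : ℝ) (j l h : ℕ) (x : ℝ) (hy0 : 0 < y) (hy1 : y < 1) (hlow : 2 * (l : ℝ) < t)
    (hhj : h ≤ j) (hcomp : t < (l : ℝ) + h) (hta : y * (h : ℝ) ≤ t) (hx : 0 ≤ x) :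
    (l : ℝ) * x + (h : ℝ) * (usage y t j l h * x) ≤ t * (x + usage y t j l h * x) := by
  have h := usage_mid_mul_le y t j l h hy0 hy1 hlow hhj hcomp hta
  have := mul_le_mul_of_nonneg_right h hx
  nlinarith

/-! ### The moved law -/

/-- **the slice at the atom `a` carries the shifted zero atom**: `slice ν a g a = (1−g)·ν a + g·ν 0`. [this work] -/
theorem slice_apply_self (ν : ℕ → ℝ) (a : ℕ) (g : ℝ) : slice ν a g a = (1 - g) * ν a + g * ν 0 := by
  simp [slice]

/-- **below the blob the slice is the unshifted copy**: `l < a` ⟹ `slice ν a g l = (1−g)·ν l`. [this work] -/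
theorem slice_apply_of_lt (ν : ℕ → ℝ) (a : ℕ) (g : ℝ) (l : ℕ) (hl : l < a) : slice ν a g l = (1 - g) * ν l := by
  simp [slice, Nat.not_le.2 hl]

/-- **law facts of the moved law** `P h = slice ν a g h + g·z·([h = 0] − [h = a])` (`1 ≤ a`, `0 ≤ g ≤ 1`, `0 ≤ z ≤ ν 0`, `ν` a
probability law on `{0..M}` with mean `S`): nonnegative, vanishing above `M + a`, mass `1`, mean `S + a·g − z·a·g`. [this work] -/
theorem moved_laws (ν : ℕ → ℝ) (a M : ℕ) (g z : ℝ) (ha : 1 ≤ a) (hg0 : 0 ≤ g) (hg1 : g ≤ 1) (hz0 : 0 ≤ z) (hzν : z ≤ ν 0)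
    (hν0 : ∀ h, 0 ≤ ν h) (hνM : ∀ h, M < h → ν h = 0) (hν1 : ∑ h ∈ Finset.range (M + 1), ν h = 1) :
    (∀ h, 0 ≤ slice ν a g h + g * z * ((if h = 0 then (1 : ℝ) else 0) - (if h = a then (1 : ℝ) else 0))) ∧
    (∀ h, M + a < h → slice ν a g h + g * z * ((if h = 0 then (1 : ℝ) else 0) - (if h = a then (1 : ℝ) else 0)) = 0) ∧
    (∑ h ∈ Finset.range (M + a + 1),
        (slice ν a g h + g * z * ((if h = 0 then (1 : ℝ) else 0) - (if h = a then (1 : ℝ) else 0))) = 1) ∧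
    (∑ h ∈ Finset.range (M + a + 1),
        (h : ℝ) * (slice ν a g h + g * z * ((if h = 0 then (1 : ℝ) else 0) - (if h = a then (1 : ℝ) else 0)))
      = (∑ h ∈ Finset.range (M + 1), (h : ℝ) * ν h) + (a : ℝ) * g - z * (a : ℝ) * g) := by
  have ha0 : a ≠ 0 := by omega
  refine ⟨fun h => ?_, fun h hh => ?_, ?_, ?_⟩
  · by_cases hha : h = a
    · subst hha
      rw [if_neg ha0, if_pos rfl, slice_apply_self]
      nlinarith [hν0 h, mul_le_mul_of_nonneg_left hzν hg0]
    · rw [if_neg hha]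
      have := slice_nonneg ν a g hg0 hg1 hν0 h
      split_ifs <;> nlinarith [mul_nonneg hg0 hz0]
  · have h0 : h ≠ 0 := by omega
    have hha : h ≠ a := by omega
    rw [if_neg h0, if_neg hha, slice_eq_zero ν a g M hνM h hh]
    ring
  · rw [Finset.sum_add_distrib, sum_slice ν a g M hνM hν1, ← Finset.mul_sum, Finset.sum_sub_distrib,
      Finset.sum_ite_eq' (Finset.range (M + a + 1)) 0, Finset.sum_ite_eq' (Finset.range (M + a + 1)) a,
      if_pos (Finset.mem_range.2 (by omega)), if_pos (Finset.mem_range.2 (by omega))]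
    ring
  · have e : ∀ h ∈ Finset.range (M + a + 1),
        (h : ℝ) * (slice ν a g h + g * z * ((if h = 0 then (1 : ℝ) else 0) - (if h = a then (1 : ℝ) else 0)))
          = (h : ℝ) * slice ν a g h + g * z * ((if h = 0 then ((h : ℕ) : ℝ) else 0) - (if h = a then ((h : ℕ) : ℝ) else 0)) := by
      intro h _
      split_ifs <;> ring
    rw [Finset.sum_congr rfl e, Finset.sum_add_distrib, sum_mul_slice ν a g M hνM hν1, ← Finset.mul_sum,
      Finset.sum_sub_distrib, Finset.sum_ite_eq' (Finset.range (M + a + 1)) 0, Finset.sum_ite_eq' (Finset.range (M + a + 1)) a,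
      if_pos (Finset.mem_range.2 (by omega)), if_pos (Finset.mem_range.2 (by omega))]
    push_cast
    ring

end LawDec

end Quant

end Summit.CriticalPhenomena.PercolationContinuityZ3.Theorems
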